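import Summits.ResolutionOfSingularities.ResolutionOfSingularities.Theses.HilbertSamuelElimination
import Summits.ResolutionOfSingularities.ResolutionOfSingularities.Theorems.HilbertSamuelEliminationSigmaMaxModificationsReductionBase
import Summits.ResolutionOfSingularities.ResolutionOfSingularities.Theorems.HilbertSamuelEliminationSigmaMaxModificationsCorridor3LevelRaiseDim
import Summits.ResolutionOfSingularities.ResolutionOfSingularities.Theorems.HilbertSamuelEliminationSigmaMaxModificationsCorridor3TameWildDefs
import Mathlib.AlgebraicGeometry.Morphisms.Proper
import Mathlib.AlgebraicGeometry.Noetherian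
import HarnessLib

/-!
# `SigmaMaxModificationsCorridor3` (stmt-ResolutionOfSingularities-19249), route HilbertSamuelElimination —
# THE LEVELS GLUE, landed: the child crux from its binding level `N = 3`

[OURS · L1 W4.2] Kernel form of the level decomposition D1 of
`Cruxes/SigmaMaxModificationsCorridor3/STRATEGY-CENSUS.md` = the sorry-free composition of line
`corridor3_levels` (`Cruxes/SigmaMaxModificationsCorridor3/Lines/corridor3_levels.lean`), now that its
provable stub `stub_levelRaiseDim` is landed (`levelRaiseDim`, p456602): NOT a statement of any manuscript.

* `hsBody_of_dim_le_three_of_base` — `B(X, N)` (`HSBody`, CJS Def. 6.15 in modification form) for every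
  level `N` and every non-regular reduced separated finite-type `X/k` with `dim X ≤ 3`, from the printed
  facts `CossartJannsenSaito2020_sigmaMaxElimination` (surfaces at level `2`,
  `sigmaMaxModifications_dim_le_two`), `CossartPiltant2019General` (isolated threefold loci at level `3`,
  `sigmaMaxModifications_dim_le_three_of_isolated`) and the open core `Corridor3@3` (corridor threefolds
  at level `3` — the hypothesis `hcor` of `sigmaMaxModifications_of_base_cores`, p164038); curves by the
  landed `stub_curve`; higher levels by `levelRaiseDim` with `d = 3`.
* `sigmaMaxModificationsCorridor3_of_base` — **`SigmaMaxModificationsCorridor3` (all levels) from the two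
  printed facts and `Corridor3@3`** — so the planner may split stmt-19249 by level
  (`--split … --into Corridor3AtThree …`, `--glue-by` this theorem), and, with the regime glue
  (`…Corridor3RegimeGlue.lean`), the all-levels quantifier of the child carries no difficulty of its own.

## Sources

* V. Cossart, U. Jannsen, S. Saito, LNM 2270 (2020): Def. 2.28, Rem. 2.29 (b), Def. 6.15, Thm. 6.28,
  Rem. 6.29. [CossartJannsenSaito2020]
* V. Cossart, O. Piltant, J. Algebra 529 (2019), Thm. 1.1. [CossartPiltant2019]
-/

set_option linter.dupNamespace false -- mandated namespace of this single-conjunct summit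

noncomputable section

open CategoryTheory AlgebraicGeometry TopologicalSpace Topology
open Literature.AlgebraicGeometry.Resolution Literature.RingTheory.HilbertSamuel
open Summit.ResolutionOfSingularities.ResolutionOfSingularities.Theses.HilbertSamuelElimination
open Summit.ResolutionOfSingularities.ResolutionOfSingularities.Theorems.SigmaMaxModifications.Sketch
open Summit.ResolutionOfSingularities.ResolutionOfSingularities.Theorems.SigmaMaxModificationsCorridor3

namespace Summit.ResolutionOfSingularities.ResolutionOfSingularities.Theorems.SigmaMaxModificationsCorridor3.TameWild

/-- **`B(X, N)` on the class `{dim ≤ 3}` at every level, from the two printed facts and the open core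
`Corridor3@3`.** Induction on `N`: `dim X ≤ N - 1` by `levelRaiseDim` (`d = 3`); at a binding level
`dim X = N`: curves (`stub_curve`), surfaces (`sigmaMaxModifications_dim_le_two`), threefolds with
`X_max(3)` isolated from `closure (Sing X ∖ X_max(3))` (`sigmaMaxModifications_dim_le_three_of_isolated`,
`X_max(3)` closed by the sharp semicontinuity over a field) or in the corridor case (`hcor`).
[cite: CossartJannsenSaito2020, Def. 6.15, Rem. 2.29 (b), Thm. 6.28] [cite: CossartPiltant2019, Thm. 1.1] -/
theorem hsBody_of_dim_le_three_of_base (hCJS : CossartJannsenSaito2020_sigmaMaxElimination.{0})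
    (hCP : CossartPiltant2019General.{0})
    (hcor : (∀ p : ℕ, p.Prime → ∀ (k : Type) [Field k] [CharP k p] (X : Scheme.{0})
      (f : X ⟶ Spec (.of k)), IsSeparated f → LocallyOfFiniteType f → QuasiCompact f →
      IsReduced X → ¬ Scheme.IsRegular X → ((3 : ℕ) : WithBot ℕ∞) ≤ topologicalKrullDim X →
      topologicalKrullDim X ≤ ((3 : ℕ) : WithBot ℕ∞) →
      ¬ Disjoint (closure ((Scheme.regularLocus X)ᶜ \ Scheme.hsMaxLocus X 3))
          (Scheme.hsMaxLocus X 3) →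
        ∃ (X' : Scheme.{0}) (π : X' ⟶ X), IsProper π ∧ IsReduced X' ∧
          topologicalKrullDim X' ≤ ((3 : ℕ) : WithBot ℕ∞) ∧
          (∀ U : X.Opens, (U : Set X) ⊆ (Scheme.hsMaxLocus X 3)ᶜ → IsIso (π ∣_ U)) ∧
          Dense ((fun x' => π.base x') ⁻¹' (Scheme.hsMaxLocus X 3)ᶜ) ∧
          (∀ x' : X', Scheme.hsFun X' 3 x' ≤ Scheme.hsFun X 3 (π.base x')) ∧
          ∀ ν : ℕ → ℕ, Maximal (· ∈ Scheme.hsValues X 3) ν → ν ∉ Scheme.hsValues X' 3))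
    (p : ℕ) (hp : p.Prime) (k : Type) [Field k] [CharP k p] :
    ∀ (N : ℕ) (X : Scheme.{0}) (f : X ⟶ Spec (.of k)), IsSeparated f →
      LocallyOfFiniteType f → QuasiCompact f → IsReduced X → ¬ Scheme.IsRegular X →
      topologicalKrullDim X ≤ ((3 : ℕ) : WithBot ℕ∞) → topologicalKrullDim X ≤ (N : WithBot ℕ∞) →
      HSBody X N := by
  intro N
  induction N with
  | zero =>
    intro X f hsep hft hqc hred hreg _ hdim
    exact stub_curve stub_curveResolution k X f hsep hft hqc hred hreg
      (hdim.trans (by exact_mod_cast (by omega : 0 ≤ 1))) 0 hdim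
  | succ N ih =>
    intro X f hsep hft hqc hred hreg hd3 hdim
    rcases dim_le_or_succ_le (topologicalKrullDim X) N with h | h
    · exact levelRaiseDim k 3 N ih X f hsep hft hqc hred hreg hd3 h
    · rcases Nat.lt_or_ge (N + 1) 2 with h1 | h2
      · exact stub_curve stub_curveResolution k X f hsep hft hqc hred hreg
          (hdim.trans (by exact_mod_cast (by omega : N + 1 ≤ 1))) (N + 1) hdim
      rcases h2.eq_or_lt with h2 | h3
      · -- surfaces at level `2`: the glued CJS fact
        obtain rfl : N = 1 := by omega
        exact sigmaMaxModifications_dim_le_two hCJS k X f hft hqc hred hreg (by exact_mod_cast hdim)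
      · -- threefolds at level `3`: isolated (Cossart–Piltant) or corridor (`hcor`)
        have hN3 : N + 1 ≤ 3 := by exact_mod_cast h.trans hd3
        obtain rfl : N = 2 := by omega
        by_cases hdisj : Disjoint (closure ((Scheme.regularLocus X)ᶜ \ Scheme.hsMaxLocus X 3))
            (Scheme.hsMaxLocus X 3)
        · haveI := hft
          haveI := hqc
          have hcl : IsClosed (Scheme.hsMaxLocus X 3) :=
            (stub_isClosed_hsMaxLocus_over_field stub_hsFun_le_of_specializes_over_field k X f hft
              hqc 3 hdim).2
          exact sigmaMaxModifications_dim_le_three_of_isolated hCP k X f hsep hft hqc hred hreg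
            (by exact_mod_cast hdim) 3 hdim hcl hdisj
        · exact hcor p hp k X f hsep hft hqc hred hreg h hdim hdisj

/-- **THE LEVELS GLUE: `SigmaMaxModificationsCorridor3` (stmt-19249, all levels `N ≥ 3`) from the two
printed facts and its binding level `Corridor3@3`.** The corridor hypothesis of the child is not used
at levels `N ≥ 4` (there `levelRaiseDim` applies on the whole class `{dim ≤ 3}`).
[cite: CossartJannsenSaito2020, Def. 6.15, Rem. 2.29 (b), Rem. 6.29] [cite: CossartPiltant2019, Thm. 1.1] -/
theorem sigmaMaxModificationsCorridor3_of_base (hCJS : CossartJannsenSaito2020_sigmaMaxElimination.{0})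
    (hCP : CossartPiltant2019General.{0})
    (hcor : (∀ p : ℕ, p.Prime → ∀ (k : Type) [Field k] [CharP k p] (X : Scheme.{0})
      (f : X ⟶ Spec (.of k)), IsSeparated f → LocallyOfFiniteType f → QuasiCompact f →
      IsReduced X → ¬ Scheme.IsRegular X → ((3 : ℕ) : WithBot ℕ∞) ≤ topologicalKrullDim X →
      topologicalKrullDim X ≤ ((3 : ℕ) : WithBot ℕ∞) →
      ¬ Disjoint (closure ((Scheme.regularLocus X)ᶜ \ Scheme.hsMaxLocus X 3))
          (Scheme.hsMaxLocus X 3) →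
        ∃ (X' : Scheme.{0}) (π : X' ⟶ X), IsProper π ∧ IsReduced X' ∧
          topologicalKrullDim X' ≤ ((3 : ℕ) : WithBot ℕ∞) ∧
          (∀ U : X.Opens, (U : Set X) ⊆ (Scheme.hsMaxLocus X 3)ᶜ → IsIso (π ∣_ U)) ∧
          Dense ((fun x' => π.base x') ⁻¹' (Scheme.hsMaxLocus X 3)ᶜ) ∧
          (∀ x' : X', Scheme.hsFun X' 3 x' ≤ Scheme.hsFun X 3 (π.base x')) ∧
          ∀ ν : ℕ → ℕ, Maximal (· ∈ Scheme.hsValues X 3) ν → ν ∉ Scheme.hsValues X' 3)) :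
    SigmaMaxModificationsCorridor3 := by
  intro p hp k _ _ X f hsep hft hqc hred hreg _ h3' N hdim _ _
  exact hsBody_of_dim_le_three_of_base hCJS hCP hcor p hp k N X f hsep hft hqc hred hreg h3' hdim

end Summit.ResolutionOfSingularities.ResolutionOfSingularities.Theorems.SigmaMaxModificationsCorridor3.TameWild

end
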